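import Summits.CriticalPhenomena.PercolationContinuityZ3.Theorems.PercNearOneGluingNoHeavyLowerTailSahiThreeCopyCellSlotFamilies
import Summits.CriticalPhenomena.PercolationContinuityZ3.Theorems.PercNearOneGluingNoHeavyLowerTailSahiThreeCopyCellF7

/-!
# `NoHeavyLowerTail` (crux stmt-CriticalPhenomena-4575), Sahi programme: the boundary slot families of `F₇ = (x₀∨x₁)(x₂∨x₃)(x₄∨x₅∨x₆)`

Support file (Sahi cell, seat `prim-sahi-p1`, generation 65; `--supports stmt-CriticalPhenomena-4575`).  Definitions only.  Freezing a front coordinate of `F₇`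
gives, up to relabelling: at a pair coordinate `Y6a = x₀ ∧ (x₁∨x₂) ∧ (x₃∨x₄∨x₅)` (value `0`) or `Y6b = (x₀∨x₁) ∧ (x₂∨x₃∨x₄)` with the dummy `x₅` (value `1`);
at a triple coordinate `C₆` (value `0`) or `X6d = C₄ + 2 dummies` (value `1`).  For `Y6a`, `Y6b`: predicate, `Finset`, integer indicator, blocks, `setInd_…_eq`,
up-set lemma (their own boundary profiles are free: up-sets on five coordinates). [this work]
-/

namespace Summit.CriticalPhenomena.PercolationContinuityZ3.Theorems.SahiThreeCopy

open Finset Function Literature.Combinatorics.Sahi2008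
open scoped BigOperators

/-- Monotonicity of a triple `||` (plumbing). [folklore] -/
theorem or3_mono_bool {a a' b b' c c' : Bool} (ha : a ≤ a') (hb : b ≤ b') (hc : c ≤ c') (h : (a || b || c) = true) :
    (a' || b' || c') = true := by
  revert ha hb hc h; cases a <;> cases a' <;> cases b <;> cases b' <;> cases c <;> cases c' <;> simp

/-! ### `Y6a = x₀ ∧ (x₁∨x₂) ∧ (x₃∨x₄∨x₅)` -/

/-- `x₀ ∧ (x₁∨x₂) ∧ (x₃∨x₄∨x₅)`. [this work] -/
def y6aB (e : Pt 6) : Bool := e 0 && (e 1 || e 2) && (e 3 || e 4 || e 5)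

/-- The slot `Y6a` as a `Finset`. [this work] -/
def Y6aSet : Finset (Pt 6) := univ.filter fun e => y6aB e = true

/-- Integer indicator of `Y6a`. [this work] -/
def y6aZ (e : Pt 6) : ℤ := if y6aB e then 1 else 0

/-- Blocks of `Y6a`: literal, pair, triple. [this work] -/
def blocksY6a : List (List (Fin 6)) := [[0], [1, 2], [3, 4, 5]]

/-- `setInd Y6aSet` is the real cast of the integer indicator. [this work] -/
theorem setInd_Y6aSet_eq : setInd Y6aSet = fun x => (y6aZ x : ℝ) := by
  funext x; rw [Y6aSet, setInd_filter_eq]; unfold y6aZ; split_ifs <;> simp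

/-- `Y6a` is an up-set. [this work] -/
theorem isUpperSet_Y6aSet : IsUpperSet ((Y6aSet : Finset (Pt 6)) : Set (Pt 6)) := by
  refine isUpperSet_filter_bool fun x y hxy hx => ?_
  simp only [y6aB, Bool.and_eq_true] at hx ⊢
  exact ⟨⟨Literature.Computability.Complexity.eq_true_of_le_of_eq_true (hxy 0) hx.1.1, or_mono_bool (hxy 1) (hxy 2) hx.1.2⟩,
    or3_mono_bool (hxy 3) (hxy 4) (hxy 5) hx.2⟩

/-! ### `Y6b = (x₀∨x₁) ∧ (x₂∨x₃∨x₄)` with the dummy `x₅` -/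

/-- `(x₀∨x₁) ∧ (x₂∨x₃∨x₄)` on six coordinates. [this work] -/
def y6bB (e : Pt 6) : Bool := (e 0 || e 1) && (e 2 || e 3 || e 4)

/-- The slot `Y6b` as a `Finset`. [this work] -/
def Y6bSet : Finset (Pt 6) := univ.filter fun e => y6bB e = true

/-- Integer indicator of `Y6b`. [this work] -/
def y6bZ (e : Pt 6) : ℤ := if y6bB e then 1 else 0

/-- Blocks of `Y6b` (coordinate `5` is in no block). [this work] -/
def blocksY6b : List (List (Fin 6)) := [[0, 1], [2, 3, 4]]

/-- `setInd Y6bSet` is the real cast of the integer indicator. [this work] -/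
theorem setInd_Y6bSet_eq : setInd Y6bSet = fun x => (y6bZ x : ℝ) := by
  funext x; rw [Y6bSet, setInd_filter_eq]; unfold y6bZ; split_ifs <;> simp

/-- `Y6b` is an up-set. [this work] -/
theorem isUpperSet_Y6bSet : IsUpperSet ((Y6bSet : Finset (Pt 6)) : Set (Pt 6)) := by
  refine isUpperSet_filter_bool fun x y hxy hx => ?_
  simp only [y6bB, Bool.and_eq_true] at hx ⊢
  exact ⟨or_mono_bool (hxy 0) (hxy 1) hx.1, or3_mono_bool (hxy 2) (hxy 3) (hxy 4) hx.2⟩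

/-- `prof7 0` is the all-ones profile `piOne7`. [this work] -/
theorem prof7_zero : prof7 0 = piOne7 := by
  funext i; simp [prof7, piOne7]

end Summit.CriticalPhenomena.PercolationContinuityZ3.Theorems.SahiThreeCopy
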